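import Summits.BirchSwinnertonDyer.BirchSwinnertonDyer.Theorems.ByReductionTypeAtTwoRankOneAtTwoBigImageOddLocalOneDoorSubslicePosDisc
import Summits.BirchSwinnertonDyer.BirchSwinnertonDyer.Theorems.GenusKolyvaginAtTwoGenusPrimitiveSupplyAtTwoArchimedeanEgg
import HarnessLib

/-!
# Route ByReductionTypeAtTwo, crux `RankOneAtTwoBigImageOddLocal` (stmt-BirchSwinnertonDyer-23715), LINE `one_door_analytic` (v8.15/v8.16, R⁺₀ side):
# -an's AN-34n «κ·m DICTIONARY» IS A THEOREM — for a RATIONAL point, «on the egg up to torsion» ⟺ «`E(ℚ)` meets the egg AND exponent `0`»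

Width prover seat `bsd-line-fkl-p2` g14 (2026-08-28), `--supports stmt-BirchSwinnertonDyer-23715` (helper).  THEOREMS ONLY (no definition, no named
fact, no `sorry`); UNCONDITIONAL (standard axioms, no printed fact as hypothesis).  BSD is not proved by any of this.

The planner seat -an g17 (MEMO-an v1.55, `g17/Sketch_v49.lean` §20.6) typed the candidate AN-34n `ANg17.RationalPointEggKappaIndexDictionaryAtTwo`
(«THEOREM-CANDIDATE, prover-sized; the converse-completion of the tree's egg lemma `eggLemma` for RATIONAL points»):
for `W/ℚ` elliptic with `Δ_W > 0`, `E(ℚ)[2] = 0`, `E(ℚ)/tors` cyclic, `K` imaginary quadratic and `P ∈ E(K)` with RATIONAL coordinates,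
`EggUpToTorsion W K P ↔ (MeetsEgg W ∧ HasTwoDivisibilityUpToTorsion W K P 0)`.  WHY IT MATTERS for the crux (AN-34 / the R⁺₀ class of v8.16): for a
`W_N = +1` datum with `L(E,1) = 0` the Heegner point `y_K` is `ℚ`-rational, so the Heegner CUSP BIT of a prime door reads `κ_E · [m = 0]` — it detects
an odd Heegner index exactly on the egg curves (`MeetsEgg`), and is blind elsewhere.  This file PROVES the dictionary (the statement `rationalPointEggKappaIndexDictionaryAtTwo`
below has -an's body VERBATIM as its type; once the typer files the `def`, `_holds` is `exact` this theorem).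

Mechanism (pure Mordell–Weil + the real place, all tree theorems): route GenusKolyvaginAtTwo's width seat gk2-p5 proved the two halves of Kramer's
`E(ℝ)/2E(ℝ) ≅ ℤ/2` for rational points — `GenusKolyArch.not_onEgg_of_add_self_eq_real` («`2E(ℝ)` misses the egg») and
`GenusKolyArch.exists_add_self_eq_real_of_not_onEgg` («a rational point OFF the egg halves over `ℝ`», complete `2`-descent at the real place) — so for
`T ∈ E(ℚ)`: `T` is an affine point ON the egg iff `ι_ℝ T ∉ 2E(ℝ)` (§2).  `2E(ℝ)` is a subgroup containing `ι_ℝ(E(ℚ)_tors)` (odd order ⟹ `2`-divisible,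
`EggDoubling.torsion_eq_two_smul`), so with `E(ℚ) = ℤg + tors`: `E(ℚ)` meets the egg iff `ι_ℝ g ∉ 2E(ℝ)`, and then `kg + t` is on the egg iff `k` is odd;
while `k` odd iff `ι_K(kg + t) ∉ 2E(K) + E(K)_tors` (→ : the egg lemma / Galois descent of halves, tree `eggLemma`; ← : `k` even exhibits a half) (§3).

* §1 exponent bookkeeping: `notTwiceUpToTorsion_of_hasTwoDivisibilityUpToTorsion_zero`, `meetsEgg_of_eggUpToTorsion`.
* §2 the real place for rational points: `not_exists_add_self_real_of_onEgg`, `exists_add_self_real_of_not_onEgg_point`, closure of «`φ T` is a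
  double» (`exists_add_self_map_add/sub/zsmul/two_mul_zsmul/of_mem_torsion`, `map_sub_two_smul_map_eq`), `onEgg_of_not_exists_add_self_real`.
* §3 **`eggUpToTorsion_iff_meetsEgg_and_exponent_zero`** (the dictionary at a rational point, hypotheses unbundled) and
  **`rationalPointEggKappaIndexDictionaryAtTwo`** (-an's AN-34n VERBATIM).

References: [Kramer1981] §2 Prop. 6 (`E(ℝ)/2E(ℝ)`); [SilvermanAEC2009] Prop. X.1.4, V.2.3.1; [Gross1984] §§3–5; [Knapp1993] Thm. 4.2.
-/

set_option autoImplicit false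
-- the Theorems namespace of this sub repeats the summit name by design (D-0017 nested layout)
set_option linter.dupNamespace false

noncomputable section

open scoped Classical

namespace Summit.BirchSwinnertonDyer.BirchSwinnertonDyer.Theorems.RankOneAtTwoOneDoor

open WeierstrassCurve Literature.NumberTheory.EllipticCurves
  Summit.BirchSwinnertonDyer.Rank1Residual.F1Sign2
open Summit.BirchSwinnertonDyer.Rank1Residual.F1Sign2.EggDoubling (psiTwo psiTwo_ne_zero torsion_eq_two_smul)
open Summit.BirchSwinnertonDyer.BirchSwinnertonDyer.Theorems.GenusKolyArch (not_onEgg_of_add_self_eq_real exists_add_self_eq_real_of_not_onEgg)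

/-! ### §1 Exponent bookkeeping -/

/-- **Exponent `0` means `P` itself is not twice a point modulo torsion**: from `P − Q ∈ tors` and `Q ∉ 2E(K) + tors`, a half of `P` modulo
torsion would be a half of `Q` modulo torsion. [folklore] -/
theorem notTwiceUpToTorsion_of_hasTwoDivisibilityUpToTorsion_zero (W : WeierstrassCurve ℚ) (K : Type) [Field K] [NumberField K]
    (P : (W.baseChange K).toAffine.Point) (h : HasTwoDivisibilityUpToTorsion W K P 0) : NotTwiceUpToTorsion W K P := by
  obtain ⟨Q, hPQ, hQ⟩ := h
  rw [pow_zero, one_smul] at hPQ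
  rintro ⟨S, hS⟩
  apply hQ
  refine ⟨S, ?_⟩
  have e : Q - 2 • S = (P - 2 • S) - (P - Q) := by abel
  rw [e]
  exact sub_mem hS hPQ

/-- **A point rational-on-the-egg up to torsion witnesses that `E(ℚ)` meets the egg** (its rational witness `(x, y)` satisfies the equation over
`ℚ`, by injectivity of `ℚ → K`). [folklore] -/
theorem meetsEgg_of_eggUpToTorsion (W : WeierstrassCurve ℚ) (K : Type) [Field K] [NumberField K]
    (P : (W.baseChange K).toAffine.Point) (h : EggUpToTorsion W K P) : MeetsEgg W := by
  obtain ⟨x, y, hK, hon, -⟩ := h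
  have h' : W.toAffine.Nonsingular x y :=
    (WeierstrassCurve.Affine.map_nonsingular (W := W.toAffine) (algebraMap ℚ K).injective x y).mp hK
  exact ⟨x, y, h'.1, hon⟩

/-! ### §2 The real place for rational points: on the egg ⟺ not in `2E(ℝ)`

Throughout, `ι_ℝ := WeierstrassCurve.Affine.Point.baseChange ℚ ℝ : E(ℚ) →+ E(ℝ)` and `ι_K := WeierstrassCurve.Affine.Point.baseChange ℚ K` (Mathlib's
base-change homomorphisms, elaborated here so that the group law on `E(ℚ)` is the one of the statement). -/

/-- **`2E(ℝ)` misses the egg (point form along `ι_ℝ : E(ℚ) → E(ℝ)`)**: a rational affine point ON the egg is not `S + S` for any real point `S`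
(gk2-p5's `GenusKolyArch.not_onEgg_of_add_self_eq_real`). [cite: Kramer1981, §2 Prop. 6] [cite: SilvermanAEC2009, III.2.3 (d)] -/
theorem not_exists_add_self_real_of_onEgg (W : WeierstrassCurve ℚ) {x y : ℚ} (h : W.toAffine.Nonsingular x y) (hon : OnEgg W x) :
    ¬ ∃ S : (W.baseChange ℝ).toAffine.Point,
      S + S = WeierstrassCurve.Affine.Point.baseChange (W' := W) ℚ ℝ (WeierstrassCurve.Affine.Point.some x y h) := by
  rintro ⟨S, hS⟩
  obtain ⟨h', hι⟩ : ∃ h', WeierstrassCurve.Affine.Point.baseChange (W' := W) ℚ ℝ (WeierstrassCurve.Affine.Point.some x y h) =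
      .some (algebraMap ℚ ℝ x) (algebraMap ℚ ℝ y) h' := ⟨_, rfl⟩
  rw [hι] at hS
  exact not_onEgg_of_add_self_eq_real W S hS hon

/-- **A rational affine point OFF the egg halves over `ℝ`** (`Δ_W > 0`, `E(ℚ)[2] = 0` so that `ψ₂(x) ≠ 0`; gk2-p5's
`GenusKolyArch.exists_add_self_eq_real_of_not_onEgg`, the complete `2`-descent at the real place). [cite: Kramer1981, §2 Prop. 6]
[cite: SilvermanAEC2009, Prop. X.1.4] -/
theorem exists_add_self_real_of_not_onEgg_point (W : WeierstrassCurve ℚ) [W.IsElliptic] (hΔ : 0 < W.Δ) (hT : NoRationalTwoTorsion W)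
    {x y : ℚ} (h : W.toAffine.Nonsingular x y) (hoff : ¬ OnEgg W x) :
    ∃ S : (W.baseChange ℝ).toAffine.Point,
      S + S = WeierstrassCurve.Affine.Point.baseChange (W' := W) ℚ ℝ (WeierstrassCurve.Affine.Point.some x y h) := by
  obtain ⟨h', hι⟩ : ∃ h', WeierstrassCurve.Affine.Point.baseChange (W' := W) ℚ ℝ (WeierstrassCurve.Affine.Point.some x y h) =
      .some (algebraMap ℚ ℝ x) (algebraMap ℚ ℝ y) h' := ⟨_, rfl⟩
  rw [hι]
  exact exists_add_self_eq_real_of_not_onEgg W hΔ (psiTwo_ne_zero W hT x) hoff h'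

/-- «`φ T` is a double» is closed under addition (any additive homomorphism `φ`). [folklore] -/
theorem exists_add_self_map_add {A B : Type*} [AddCommGroup A] [AddCommGroup B] (φ : A →+ B) {T₁ T₂ : A}
    (h₁ : ∃ S : B, S + S = φ T₁) (h₂ : ∃ S : B, S + S = φ T₂) : ∃ S : B, S + S = φ (T₁ + T₂) := by
  obtain ⟨S₁, hS₁⟩ := h₁
  obtain ⟨S₂, hS₂⟩ := h₂
  refine ⟨S₁ + S₂, ?_⟩
  rw [φ.map_add, ← hS₁, ← hS₂]
  abel

/-- «`φ T` is a double» is closed under subtraction. [folklore] -/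
theorem exists_add_self_map_sub {A B : Type*} [AddCommGroup A] [AddCommGroup B] (φ : A →+ B) {T₁ T₂ : A}
    (h₁ : ∃ S : B, S + S = φ T₁) (h₂ : ∃ S : B, S + S = φ T₂) : ∃ S : B, S + S = φ (T₁ - T₂) := by
  obtain ⟨S₁, hS₁⟩ := h₁
  obtain ⟨S₂, hS₂⟩ := h₂
  refine ⟨S₁ - S₂, ?_⟩
  rw [φ.map_sub, ← hS₁, ← hS₂]
  abel

/-- «`φ T` is a double» is closed under integer multiples. [folklore] -/
theorem exists_add_self_map_zsmul {A B : Type*} [AddCommGroup A] [AddCommGroup B] (φ : A →+ B) {T : A} (k : ℤ)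
    (h : ∃ S : B, S + S = φ T) : ∃ S : B, S + S = φ (k • T) := by
  obtain ⟨S, hS⟩ := h
  refine ⟨k • S, ?_⟩
  rw [φ.map_zsmul, ← hS, smul_add]

/-- An EVEN multiple is a double. [folklore] -/
theorem exists_add_self_map_two_mul_zsmul {A B : Type*} [AddCommGroup A] [AddCommGroup B] (φ : A →+ B) (T : A) (k : ℤ) :
    ∃ S : B, S + S = φ ((2 * k) • T) :=
  ⟨φ (k • T), by rw [← φ.map_add, ← two_smul ℤ (k • T), smul_smul]⟩

/-- `φ P₀ − 2·φ(k'g) = φ(P₀ − (k' + k')g)` (bookkeeping for an even coefficient). [folklore] -/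
theorem map_sub_two_smul_map_eq {A B : Type*} [AddCommGroup A] [AddCommGroup B] (φ : A →+ B) (P₀ g : A) (k' : ℤ) :
    φ P₀ - 2 • φ (k' • g) = φ (P₀ - (k' + k') • g) := by
  rw [φ.map_sub, add_zsmul, φ.map_add, two_nsmul]

/-- **Rational torsion maps to doubles** (`E(ℚ)[2] = 0`: a rational torsion point has odd order, so it is twice a rational point,
`EggDoubling.torsion_eq_two_smul`; any additive homomorphism `φ` out of `E(ℚ)`). [folklore] -/
theorem exists_add_self_map_of_mem_torsion (W : WeierstrassCurve ℚ) (hT : NoRationalTwoTorsion W) {B : Type*} [AddCommGroup B]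
    (φ : W.toAffine.Point →+ B) {t : W.toAffine.Point} (ht : t ∈ AddCommGroup.torsion W.toAffine.Point) : ∃ S : B, S + S = φ t := by
  obtain ⟨t₁, rfl⟩ := torsion_eq_two_smul W hT t ht
  exact ⟨φ t₁, by rw [two_nsmul, φ.map_add]⟩

/-- **A rational point outside `ι_ℝ⁻¹(2E(ℝ))` is an affine point ON the egg** (`Δ_W > 0`, `E(ℚ)[2] = 0`): `O ∈ 2E(ℝ)`, and an affine point
off the egg halves over `ℝ`. [cite: Kramer1981, §2 Prop. 6] -/
theorem onEgg_of_not_exists_add_self_real (W : WeierstrassCurve ℚ) [W.IsElliptic] (hΔ : 0 < W.Δ) (hT : NoRationalTwoTorsion W)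
    (T : W.toAffine.Point)
    (h : ¬ ∃ S : (W.baseChange ℝ).toAffine.Point, S + S = WeierstrassCurve.Affine.Point.baseChange (W' := W) ℚ ℝ T) :
    ∃ (x y : ℚ) (hxy : W.toAffine.Nonsingular x y), T = WeierstrassCurve.Affine.Point.some x y hxy ∧ OnEgg W x := by
  rcases T with _ | ⟨x, y, hxy⟩
  · exact absurd ⟨0, by rw [add_zero]; rfl⟩ h
  · by_cases hon : OnEgg W x
    · exact ⟨x, y, hxy, rfl, hon⟩
    · exact absurd (exists_add_self_real_of_not_onEgg_point W hΔ hT hxy hon) h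

/-! ### §3 The dictionary -/

/-- **THE κ·m DICTIONARY AT A RATIONAL POINT (hypotheses unbundled).**  `W/ℚ` elliptic, `Δ_W > 0`, `E(ℚ)[2] = 0`, `E(ℚ) = ℤg + E(ℚ)_tors` for some `g`;
`K` imaginary quadratic; `(x, y)` a rational point, read in `E(K)`.  THEN `(x, y)` is on the egg up to `K`-torsion iff `E(ℚ)` meets the egg AND
`(x, y) ∉ 2E(K) + E(K)_tors` (exponent `0`).  (→) the egg lemma (`eggLemma`, Galois descent of halves) and the rational witness; (←) write
`(x, y) = kg + t`: exponent `0` in `E(K)` forces `k` odd (an even `k` exhibits a half), `E(ℚ)` meeting the egg forces `ι_ℝ g ∉ 2E(ℝ)` (else every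
rational point, being `jg + t'` with `t'` of odd order, would lie in `2E(ℝ)`, which misses the egg), and then `ι_ℝ(kg + t) ∉ 2E(ℝ)` (else
`ι_ℝ g = ι_ℝ(kg + t) − ι_ℝ t − 2·((k−1)/2)·ι_ℝ g ∈ 2E(ℝ)`), i.e. `(x, y)` is on the egg.  UNCONDITIONAL. [cite: Kramer1981, §2 Prop. 6]
[cite: Gross1984, §§3–5] [cite: SilvermanAEC2009, Prop. X.1.4 and V.2.3.1] -/
theorem eggUpToTorsion_iff_meetsEgg_and_exponent_zero (W : WeierstrassCurve ℚ) [W.IsElliptic] (hΔ : 0 < W.Δ) (hT : NoRationalTwoTorsion W)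
    (hcyc : ∃ g : W.toAffine.Point, ∀ P : W.toAffine.Point, ∃ k : ℤ, P - k • g ∈ AddCommGroup.torsion W.toAffine.Point)
    (K : Type) [Field K] [NumberField K] (hK : IsImaginaryQuadratic K)
    (x y : ℚ) (h : (W.baseChange K).toAffine.Nonsingular (algebraMap ℚ K x) (algebraMap ℚ K y)) :
    EggUpToTorsion W K (WeierstrassCurve.Affine.Point.some _ _ h) ↔
      (MeetsEgg W ∧ HasTwoDivisibilityUpToTorsion W K (WeierstrassCurve.Affine.Point.some _ _ h) 0) := by
  refine ⟨fun hegg => ⟨meetsEgg_of_eggUpToTorsion W K _ hegg, hasTwoDivisibilityUpToTorsion_zero_of_eggUpToTorsion W hΔ hT K hK _ hegg⟩,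
    fun hme => ?_⟩
  obtain ⟨hmeets, hexp⟩ := hme
  -- the two base-change homomorphisms, with `E(ℚ)`'s group law as in the statement
  set ιR : W.toAffine.Point →+ (W.baseChange ℝ).toAffine.Point := WeierstrassCurve.Affine.Point.baseChange (W' := W) ℚ ℝ with hιR
  set ιK : W.toAffine.Point →+ (W.baseChange K).toAffine.Point := WeierstrassCurve.Affine.Point.baseChange (W' := W) ℚ K with hιK
  -- the rational point `P₀ = (x, y) ∈ E(ℚ)` with `ι_K P₀ = P`
  have h₀ : W.toAffine.Nonsingular x y :=
    (WeierstrassCurve.Affine.map_nonsingular (W := W.toAffine) (algebraMap ℚ K).injective x y).mp h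
  have hιP : ιK (WeierstrassCurve.Affine.Point.some x y h₀) = WeierstrassCurve.Affine.Point.some _ _ h := rfl
  -- `E(ℚ) = ℤ g + tors`: `P₀ = k g + t`, and an egg point `R₀ = j g + t'`
  obtain ⟨g, hg⟩ := hcyc
  obtain ⟨k, hk⟩ := hg (WeierstrassCurve.Affine.Point.some x y h₀)
  obtain ⟨x', y', heq', hon'⟩ := hmeets
  have h' : W.toAffine.Nonsingular x' y' := (Affine.equation_iff_nonsingular (W := W)).mp heq'
  obtain ⟨j, hj⟩ := hg (WeierstrassCurve.Affine.Point.some x' y' h')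
  -- (a) `ι_ℝ g ∉ 2E(ℝ)`: else the egg point `R₀ = (R₀ − j g) + j g` would lie in `2E(ℝ)`
  have hg2 : ¬ ∃ S : (W.baseChange ℝ).toAffine.Point, S + S = ιR g := by
    intro hS
    obtain ⟨S, hS'⟩ :=
      exists_add_self_map_add ιR (exists_add_self_map_of_mem_torsion W hT ιR hj) (exists_add_self_map_zsmul ιR j hS)
    have e : WeierstrassCurve.Affine.Point.some x' y' h' - j • g + j • g = WeierstrassCurve.Affine.Point.some x' y' h' := by abel
    rw [e] at hS'
    exact not_exists_add_self_real_of_onEgg W h' hon' ⟨S, hS'⟩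
  -- (b) `k` is odd: an even `k` would make `P = 2 • ι_K(k' g) + ι_K(t)` twice a point modulo torsion
  have hPnt : NotTwiceUpToTorsion W K (WeierstrassCurve.Affine.Point.some _ _ h) :=
    notTwiceUpToTorsion_of_hasTwoDivisibilityUpToTorsion_zero W K _ hexp
  have hkodd : Odd k := by
    rcases Int.even_or_odd k with ⟨k', hk'⟩ | hodd
    · exfalso
      apply hPnt
      refine ⟨ιK (k' • g), ?_⟩
      rw [hk'] at hk
      rw [← hιP, map_sub_two_smul_map_eq ιK]
      exact (AddCommGroup.mem_torsion _).mpr (AddMonoidHom.isOfFinAddOrder ιK ((AddCommGroup.mem_torsion _).mp hk))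
    · exact hodd
  obtain ⟨k', hk'⟩ := hkodd
  -- (c) `P₀` is on the egg: else `ι_ℝ P₀ ∈ 2E(ℝ)`, hence `ι_ℝ (k g) ∈ 2E(ℝ)`, hence `ι_ℝ g = ι_ℝ(k g) − 2k'·ι_ℝ g ∈ 2E(ℝ)`, contradicting (a)
  have hP₀2 : ¬ ∃ S : (W.baseChange ℝ).toAffine.Point, S + S = ιR (WeierstrassCurve.Affine.Point.some x y h₀) := by
    intro hS
    apply hg2
    have hkg : ∃ S : (W.baseChange ℝ).toAffine.Point, S + S = ιR (k • g) := by
      have e : k • g = WeierstrassCurve.Affine.Point.some x y h₀ - (WeierstrassCurve.Affine.Point.some x y h₀ - k • g) := by abel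
      rw [e]
      exact exists_add_self_map_sub ιR hS (exists_add_self_map_of_mem_torsion W hT ιR hk)
    have e : g = k • g - (2 * k') • g := by rw [hk', add_zsmul, one_zsmul]; abel
    rw [e]
    exact exists_add_self_map_sub ιR hkg (exists_add_self_map_two_mul_zsmul ιR g k')
  obtain ⟨x₁, y₁, hxy₁, hP₀eq, hon₁⟩ :=
    onEgg_of_not_exists_add_self_real W hΔ hT (WeierstrassCurve.Affine.Point.some x y h₀) hP₀2
  rw [WeierstrassCurve.Affine.Point.some.injEq] at hP₀eq
  obtain ⟨rfl, rfl⟩ := hP₀eq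
  exact ⟨x, y, h, hon₁, by rw [sub_self]; exact zero_mem _⟩

/-- **-an's AN-34n `RationalPointEggKappaIndexDictionaryAtTwo` IS A THEOREM** (body VERBATIM from `g17/Sketch_v49.lean` §20.6 as the type): for `W/ℚ`
elliptic with `Δ_W > 0`, `E(ℚ)[2] = 0` (`NoRationalTwoTorsion`), `E(ℚ)/tors` cyclic, `K` imaginary quadratic and a point of `E(K)` with RATIONAL coordinates:
on the egg up to torsion ⟺ `E(ℚ)` meets the egg ∧ `2`-divisibility exponent `0`.  UNCONDITIONAL; BSD is not proved by this (it is the Mordell–Weil /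
real-place dictionary through which the Heegner cusp bit of AN-34 reads `κ_E · [m = 0]`). [cite: Kramer1981, §2 Prop. 6] [cite: Gross1984, §§3–5]
[cite: SilvermanAEC2009, Prop. X.1.4 and V.2.3.1] -/
theorem rationalPointEggKappaIndexDictionaryAtTwo :
    ∀ (W : WeierstrassCurve ℚ) [W.IsElliptic], 0 < W.Δ → NoRationalTwoTorsion W →
      (∃ g : W.toAffine.Point, ∀ P : W.toAffine.Point, ∃ k : ℤ, P - k • g ∈ AddCommGroup.torsion W.toAffine.Point) →
      ∀ (K : Type) [Field K] [NumberField K], IsImaginaryQuadratic K →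
      ∀ (x y : ℚ) (h : (W.baseChange K).toAffine.Nonsingular (algebraMap ℚ K x) (algebraMap ℚ K y)),
        (EggUpToTorsion W K (WeierstrassCurve.Affine.Point.some _ _ h) ↔
          (MeetsEgg W ∧ HasTwoDivisibilityUpToTorsion W K (WeierstrassCurve.Affine.Point.some _ _ h) 0)) :=
  fun W _ hΔ hT hcyc K _ _ hK x y h => eggUpToTorsion_iff_meetsEgg_and_exponent_zero W hΔ hT hcyc K hK x y h

end Summit.BirchSwinnertonDyer.BirchSwinnertonDyer.Theorems.RankOneAtTwoOneDoor

end
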